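import Literature.NumberTheory.LFunctions.DegreeOnePrimesPNT
import Literature.NumberTheory.Sieve.FriedlanderIwaniecPrimesProp21
import Literature.NumberTheory.Sieve.FriedlanderIwaniecPrimesSquarefreeProofs
import HarnessLib

/-!
# Hypothesis (2.7) for Friedlander–Iwaniec's sequence `a² + b⁴`, proved unconditionally: Mertens'
# theorem for the density `g` of (3.16) with a prime-number-theorem error term

Family `parity`, statement parity.S17. Source: J. Friedlander, H. Iwaniec, *The polynomial
`X² + Y⁴` captures its primes*, Ann. of Math. (2) 148 (1998), 945–1040
[FriedlanderIwaniecAnnals1998], §3, the paragraph after Proposition 3.5: "The asymptotic formula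
(2.7) is derived from the Prime Number Theorem for the primes in residue classes modulo four."

This file DISCHARGES the named fact `Literature.NumberTheory.Sieve.FriedlanderIwaniec1998_hyp27`
(`FriedlanderIwaniecPrimes.lean`): there are `c, K` with
`|∑_{p ≤ y} g(p) − (log log y + c)| ≤ K (log y)^{-10}` for all `y ≥ 2`, where `g` is FI's
density (3.16) (`fiDensity`; `g(p) = (1 + χ₄(p)(1 − 1/p))/p`). The sibling file
`FriedlanderIwaniecPrimesHyp27.lean` derives the same fact from the named fact `siegel_walfisz`
(parity.S28); the present proof needs NO analytic named fact.

* `FriedlanderIwaniec1998_hyp27_holds : FriedlanderIwaniec1998_hyp27` — PROVED: the prime number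
  theorem modulo `4` enters through the tree's PROVED prime ideal theorem for
  `ℚ(i) = ℚ[X]/(X² + 1)` (`Literature/NumberTheory/LFunctions/DegreeOnePrimesPNT`:
  `∑_{p ≤ x} ν(p)/p = log log x + c + O_A((log x)^{-A})` for the root count `ν(p)` of `X² + 1`
  modulo `p`, which is FI's `ρ(p) = 1 + χ₄(p)` (`p` odd), `ρ(2) = 1`), together with
  `g(p) = ρ(p)/p − χ₄(p)/p²` and the absolutely convergent tail `∑_{p > y} 1/p² ≤ 2/⌊y⌋`;
  more generally `sum_primesLE_eq_loglog_of_abs_sub_fiRho_div_le`: (2.7) holds for every `w` with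
  `|w(p) − ρ(p)/p| ≤ M/p²` (e.g. the density `g'` of the squarefree-supported sequence `μ² a` of
  `FriedlanderIwaniecPrimesSquarefree`, `|g − g'| ≤ g(p²)`).
* Consequently parity.S17 (`friedlanderIwaniecSum_isEquivalent`, FI Theorem 1 in `IsEquivalent`
  form) follows from exactly THREE deep named facts, along either of the two routes of the tree:
  `friedlanderIwaniecSum_isEquivalent_of_printedInputs` — Propositions 2.1, 3.5, 4.1 AS PRINTED
  (`_prop21`, `_prop35`, `_prop41`), through the squarefree-supported sequence `μ²(n) a_n` of
  `FriedlanderIwaniecPrimesSquarefreeProofs` (`…_of_sq_inputs`); and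
  `friedlanderIwaniecSum_isEquivalent_of_deepInputs` — Proposition 2.1 in the form its proof
  consumes (`_prop21_consumed`, [FriedlanderIwaniecASP1998] Theorems 2–3 with the cubefree (2.8)
  and the divisor moment (2.8′)), 3.5 and 4.1, through `FriedlanderIwaniecPrimesProp21`
  (`…_of_consumedInputs`). Also the (4.7)-forms and the qualitative clause
  (`setOf_prime_sq_add_pow_four_infinite_of_printedInputs`, `…_of_deepInputs`), and
  `fiSieveSeq_hypothesesCubefree'` (the hypotheses (2.1)–(2.15), cubefree (2.8), for `a_n` from
  Propositions 3.5 and 4.1 alone).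

## References

* J. Friedlander, H. Iwaniec, Ann. of Math. (2) 148 (1998), 945–1040, §3 (after Prop. 3.5),
  (2.7), (3.16). [cite: FriedlanderIwaniecAnnals1998, §3, hypothesis (2.7)]
* E. Landau, Math. Ann. 56 (1903), 645–670 (prime ideal theorem; here for `ℚ(i)`).
  [cite: LandauMathAnn1903, §13]

## Mathlib / tree

Tree: `Literature.NumberTheory.LFunctions.DegreeOnePrimes.sum_primesLE_rootCount_div_eq` (`DegreeOnePrimesPNT`), `fiRho`,
`fiRho_prime`, `fiDensity_prime`, `FriedlanderIwaniec1998_hyp27` (`FriedlanderIwaniecPrimes`),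
`friedlanderIwaniecSum_isEquivalent_of_consumedInputs` (`…Prop21`), `…_of_sq_inputs` and
`FriedlanderIwaniecPrimesSquarefree.log_pow_ten_le` (`…SquarefreeProofs`),
`fiSieveSeq_hypothesesCubefree` (`…CrudeBound`), `abs_chi4R_le_one` (`…Proofs`). Mathlib: `sum_Ioo_inv_sq_le`,
`cauchySeq_tendsto_of_complete`, `ZMod.χ₄_nat_eq_if_mod_four`. No definitions are introduced.
-/

noncomputable section

open Finset Real Filter Polynomial
open scoped Topology

namespace Literature.NumberTheory.Sieve

namespace FriedlanderIwaniecPrimes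

/-! ### `ρ(p)` is the root count of `X² + 1` modulo `p` -/

/-- `X² + 1 ∈ ℤ[X]` is monic. [folklore] -/
theorem monic_X_sq_add_one : (X ^ 2 + 1 : ℤ[X]).Monic := monic_X_pow_add_C 1 two_ne_zero

/-- `X² + 1` is irreducible in `ℤ[X]` (monic without rational roots; the same twelve lines as
`Literature.NumberTheory.Sieve.irreducible_X_sq_add_one_int` of `AletheiaZomleferFukshanskyGarcia2020Applications`, repeated
to keep the imports of this file small). [folklore] -/
theorem irreducible_X_sq_add_one : Irreducible (X ^ 2 + 1 : ℤ[X]) := by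
  rw [monic_X_sq_add_one.irreducible_iff_irreducible_map_fraction_map (K := ℚ)]
  have hmap : (X ^ 2 + 1 : ℤ[X]).map (algebraMap ℤ ℚ) = X ^ 2 + 1 := by simp
  rw [hmap]
  have hdeg : (X ^ 2 + 1 : ℚ[X]).natDegree = 2 := by
    simpa using natDegree_X_pow_add_C (n := 2) (r := (1 : ℚ))
  refine (irreducible_iff_roots_eq_zero_of_degree_le_three (by omega) (by omega)).mpr ?_
  refine Multiset.eq_zero_of_forall_notMem fun r hr ↦ ?_
  have hne : (X ^ 2 + 1 : ℚ[X]) ≠ 0 := (monic_X_pow_add_C 1 two_ne_zero).ne_zero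
  rw [mem_roots hne, IsRoot, eval_add, eval_pow, eval_X, eval_one] at hr
  nlinarith [sq_nonneg r]

/-- FI's `ρ(p)` (`fiRho p = #{α mod p : α² + 1 ≡ 0}`) is the root count
`ν(p) = #{n ∈ {0,…,p−1} : p ∣ n² + 1}` of `X² + 1` in the normalisation of
`Literature.DegreeOnePrimes`. [cite: FriedlanderIwaniecAnnals1998, §3, definition of ρ(d)] -/
theorem rootCount_X_sq_add_one_eq_fiRho (p : ℕ) :
    #((range p).filter fun n : ℕ => (p : ℤ) ∣ (X ^ 2 + 1 : ℤ[X]).eval (n : ℤ)) = fiRho p := by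
  unfold fiRho
  congr 1
  ext n
  simp only [mem_filter, mem_range, eval_add, eval_pow, eval_X, eval_one, and_congr_right_iff]
  intro _
  rw [show ((n : ℤ) ^ 2 + 1 : ℤ) = ((n ^ 2 + 1 : ℕ) : ℤ) by push_cast; ring, Int.natCast_dvd_natCast]

/-- **Mertens' theorem for `ρ(p)/p` with a prime-number-theorem error term**: for every `A` there
are `c, C` with `|∑_{p ≤ x} ρ(p)/p − (log log x + c)| ≤ C/(log x)^{A+1}` for `x ≥ 2` — the
prime number theorem for the primes `p ≡ 1 (mod 4)` (`ρ(p) = 1 + χ₄(p)`), obtained from the prime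
ideal theorem for `ℚ(i)` (`Literature.NumberTheory.LFunctions.DegreeOnePrimes.sum_primesLE_rootCount_div_eq` with `g = X² + 1`).
[cite: FriedlanderIwaniecAnnals1998, §3, paragraph after Proposition 3.5] -/
theorem sum_primesLE_fiRho_div_eq (A : ℕ) :
    ∃ c C : ℝ, ∀ x : ℝ, 2 ≤ x →
      |∑ p ∈ Nat.primesLE ⌊x⌋₊, (fiRho p : ℝ) / p - (Real.log (Real.log x) + c)| ≤
        C / Real.log x ^ (A + 1) := by
  obtain ⟨c, C, h⟩ :=
    LFunctions.DegreeOnePrimes.sum_primesLE_rootCount_div_eq monic_X_sq_add_one irreducible_X_sq_add_one A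
  refine ⟨c, C, fun x hx => ?_⟩
  have := h x hx
  simpa only [rootCount_X_sq_add_one_eq_fiRho] using this

/-! ### `g(p) = ρ(p)/p − χ₄(p)/p²` and the tail `∑_{p > y} χ₄(p)/p²` -/

/-- (3.16) at primes rewritten through `ρ`: `g(p) = ρ(p)/p − χ₄(p)/p²` for every prime `p`
(`ρ(p) = 1 + χ₄(p)` for `p` odd, `fiRho_prime`; `g(2) = 1/2`, `ρ(2) = 1`, `χ₄(2) = 0`).
[cite: FriedlanderIwaniecAnnals1998, (3.16)] -/
theorem fiDensity_prime_eq_fiRho_div_sub {p : ℕ} (hp : p.Prime) :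
    fiDensity p = (fiRho p : ℝ) / p - (ZMod.χ₄ p : ℝ) / (p : ℝ) ^ 2 := by
  have hρ : (fiRho p : ℝ) = 1 + (ZMod.χ₄ p : ℝ) := by
    rcases eq_or_ne p 2 with rfl | hp2
    · rw [fiRho_two, ZMod.χ₄_nat_eq_if_mod_four]
      norm_num
    · have h := congrArg (Int.cast : ℤ → ℝ) (fiRho_prime hp hp2)
      push_cast at h
      exact h
  rw [fiDensity_prime hp, hρ]
  have hp0 : (p : ℝ) ≠ 0 := by exact_mod_cast hp.ne_zero
  field_simp
  ring

/-- **Tails of absolutely convergent prime sums**: if `|a(p)| ≤ M/p²` at primes then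
`|∑_{p ≤ N'} a(p) − ∑_{p ≤ N} a(p)| ≤ 2M/N` for `1 ≤ N ≤ N'` (`∑_{n > N} 1/n² ≤ 2/(N+1)`,
Mathlib `sum_Ioo_inv_sq_le`). [folklore] -/
theorem abs_sum_primesLE_sub_sum_primesLE_le {a : ℕ → ℝ} {M : ℝ}
    (ha : ∀ p : ℕ, p.Prime → |a p| ≤ M / (p : ℝ) ^ 2) {N N' : ℕ} (hN : 1 ≤ N) (hNN' : N ≤ N') :
    |∑ p ∈ Nat.primesLE N', a p - ∑ p ∈ Nat.primesLE N, a p| ≤ 2 * M / N := by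
  have hM : 0 ≤ M := by
    have h := (abs_nonneg _).trans (ha 2 Nat.prime_two)
    rw [le_div_iff₀ (by positivity), zero_mul] at h
    exact h
  have hsub : Nat.primesLE N ⊆ Nat.primesLE N' := Nat.primesLE_mono hNN'
  rw [← sum_sdiff hsub, add_sub_cancel_right]
  have hdiff : Nat.primesLE N' \ Nat.primesLE N ⊆ Ioc N N' := by
    intro p hp
    obtain ⟨hp1, hp2⟩ := mem_sdiff.mp hp
    obtain ⟨hpN', hpp⟩ := Nat.mem_primesLE.mp hp1
    have hnot : ¬ p ≤ N := fun h => hp2 (Nat.mem_primesLE.mpr ⟨h, hpp⟩)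
    exact mem_Ioc.mpr ⟨not_le.mp hnot, hpN'⟩
  have hN0 : (0 : ℝ) < N := by exact_mod_cast hN
  calc |∑ p ∈ Nat.primesLE N' \ Nat.primesLE N, a p|
      ≤ ∑ p ∈ Nat.primesLE N' \ Nat.primesLE N, |a p| := abs_sum_le_sum_abs _ _
    _ ≤ ∑ p ∈ Nat.primesLE N' \ Nat.primesLE N, M * ((p : ℝ) ^ 2)⁻¹ := by
        refine sum_le_sum fun p hp => ?_
        rw [← div_eq_mul_inv]
        exact ha p (Nat.mem_primesLE.mp (mem_sdiff.mp hp).1).2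
    _ ≤ ∑ n ∈ Ioc N N', M * ((n : ℝ) ^ 2)⁻¹ :=
        sum_le_sum_of_subset_of_nonneg hdiff fun n _ _ => by positivity
    _ ≤ ∑ n ∈ Ioo N (N' + 1), M * ((n : ℝ) ^ 2)⁻¹ := by
        refine sum_le_sum_of_subset_of_nonneg (fun n hn => ?_) fun n _ _ => by positivity
        rw [mem_Ioc] at hn
        rw [mem_Ioo]
        omega
    _ = M * ∑ n ∈ Ioo N (N' + 1), ((n : ℝ) ^ 2)⁻¹ := by rw [mul_sum]
    _ ≤ M * (2 / (N + 1)) := mul_le_mul_of_nonneg_left (sum_Ioo_inv_sq_le N (N' + 1)) hM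
    _ ≤ M * (2 / N) := by
        refine mul_le_mul_of_nonneg_left ?_ hM
        exact div_le_div_of_nonneg_left (by norm_num) hN0 (by linarith)
    _ = 2 * M / N := by ring

/-- **Absolutely convergent prime sums, with tail bound**: if `|a(p)| ≤ M/p²` at primes then
`∑_{p ≤ N} a(p)` converges, to `T` say, and `|T − ∑_{p ≤ N} a(p)| ≤ 2M/N` for `N ≥ 1`.
[folklore] -/
theorem exists_tendsto_sum_primesLE_of_abs_le {a : ℕ → ℝ} {M : ℝ}
    (ha : ∀ p : ℕ, p.Prime → |a p| ≤ M / (p : ℝ) ^ 2) :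
    ∃ T : ℝ, Tendsto (fun N => ∑ p ∈ Nat.primesLE N, a p) atTop (𝓝 T) ∧
      ∀ N : ℕ, 1 ≤ N → |T - ∑ p ∈ Nat.primesLE N, a p| ≤ 2 * M / N := by
  set U : ℕ → ℝ := fun N => ∑ p ∈ Nat.primesLE N, a p with hU
  have hM : 0 ≤ 2 * M := by
    have h := abs_sum_primesLE_sub_sum_primesLE_le ha le_rfl (le_refl 1)
    rw [sub_self, abs_zero, Nat.cast_one, div_one] at h
    exact h
  have hcauchy : CauchySeq U := by
    refine Metric.cauchySeq_iff'.mpr fun ε hε => ?_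
    obtain ⟨N, hN⟩ := exists_nat_gt ((2 * M + 1) / ε)
    refine ⟨max N 1, fun n hn => ?_⟩
    have h1 : 1 ≤ max N 1 := le_max_right _ _
    have hM0 : (0 : ℝ) < ((max N 1 : ℕ) : ℝ) := by exact_mod_cast h1
    have hM' : (2 * M + 1) / ε < ((max N 1 : ℕ) : ℝ) :=
      hN.trans_le (Nat.cast_le.mpr (le_max_left N 1))
    have hMε : (2 * M) / ((max N 1 : ℕ) : ℝ) < ε := by
      rw [div_lt_iff₀ hε] at hM'
      rw [div_lt_iff₀ hM0]
      nlinarith [mul_comm ε ((max N 1 : ℕ) : ℝ)]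
    rw [Real.dist_eq]
    exact (abs_sum_primesLE_sub_sum_primesLE_le ha h1 hn).trans_lt hMε
  obtain ⟨T, hT⟩ := cauchySeq_tendsto_of_complete hcauchy
  refine ⟨T, hT, fun N hN => ?_⟩
  have hlim : Tendsto (fun N' => |U N' - U N|) atTop (𝓝 |T - U N|) :=
    (continuous_abs.tendsto _).comp (hT.sub_const _)
  exact le_of_tendsto hlim (Filter.eventually_atTop.mpr ⟨N, fun N' hN' =>
    abs_sum_primesLE_sub_sum_primesLE_le ha hN hN'⟩)

end FriedlanderIwaniecPrimes

open FriedlanderIwaniecPrimes in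
/-- **Mertens' theorem with rate for any perturbation of `ρ(p)/p` by `O(1/p²)`**: if
`|w(p) − ρ(p)/p| ≤ M/p²` at all primes, then there are `c, K` with
`|∑_{p ≤ y} w(p) − (log log y + c)| ≤ K (log y)^{-10}` for all `y ≥ 2`
(`sum_primesLE_fiRho_div_eq` plus the absolutely convergent part
`exists_tendsto_sum_primesLE_of_abs_le`, whose tail `2M/⌊y⌋ ≤ 4M/y` is `≤ 4M · 10^{10}/(log y)^{10}`,
`FriedlanderIwaniecPrimesSquarefree.log_pow_ten_le`).
Used below with `w = g` (FI's density (3.16)); it applies verbatim to the density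
`g'(p) = (g(p) − g(p²))/(1 − g(p²))` of the squarefree-supported sequence `μ²(n) a_n`
(`FriedlanderIwaniecPrimesSquarefree`, `|g(p) − g'(p)| ≤ g(p²) ≪ 1/p²`). [folklore] -/
theorem sum_primesLE_eq_loglog_of_abs_sub_fiRho_div_le {w : ℕ → ℝ} {M : ℝ}
    (hw : ∀ p : ℕ, p.Prime → |w p - (fiRho p : ℝ) / p| ≤ M / (p : ℝ) ^ 2) :
    ∃ c K : ℝ, ∀ y : ℝ, 2 ≤ y →
      |(∑ p ∈ Nat.primesLE ⌊y⌋₊, w p) - (Real.log (Real.log y) + c)| ≤ K / Real.log y ^ 10 := by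
  obtain ⟨c₁, C₁, h₁⟩ := sum_primesLE_fiRho_div_eq 9
  obtain ⟨T, -, hT⟩ := exists_tendsto_sum_primesLE_of_abs_le hw
  have hM : 0 ≤ 2 * M := by
    have h := hT 1 le_rfl
    rw [Nat.cast_one, div_one] at h
    exact (abs_nonneg _).trans h
  refine ⟨c₁ + T, C₁ + 4 * M * 10 ^ 10, fun y hy => ?_⟩
  have hy0 : 0 < y := by linarith
  have hy1 : 1 ≤ y := by linarith
  have hL : 0 < Real.log y := Real.log_pos (by linarith)
  have hmain : |∑ p ∈ Nat.primesLE ⌊y⌋₊, (fiRho p : ℝ) / p - (Real.log (Real.log y) + c₁)| ≤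
      C₁ / Real.log y ^ 10 := h₁ y hy
  set N := ⌊y⌋₊ with hN
  have hN2 : 2 ≤ N := Nat.le_floor (by simpa using hy)
  have hN1 : 1 ≤ N := by omega
  -- the decomposition `∑ w(p) = ∑ ρ(p)/p + ∑ (w(p) − ρ(p)/p)`
  have hsum : ∑ p ∈ Nat.primesLE N, w p =
      ∑ p ∈ Nat.primesLE N, (fiRho p : ℝ) / p +
        ∑ p ∈ Nat.primesLE N, (w p - (fiRho p : ℝ) / p) := by
    rw [← sum_add_distrib]
    exact sum_congr rfl fun p _ => by ring
  have htail := hT N hN1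
  -- `2M/N ≤ 4M/y ≤ 4M · 10^10/(log y)^10`
  have hNy : y ≤ 2 * N := by
    have h1 : y < N + 1 := Nat.lt_floor_add_one y
    have h2 : (2 : ℝ) ≤ N := by exact_mod_cast hN2
    linarith
  have hN0 : (0 : ℝ) < N := by exact_mod_cast (by omega : 0 < N)
  have htail' : |T - ∑ p ∈ Nat.primesLE N, (w p - (fiRho p : ℝ) / p)| ≤
      4 * M * 10 ^ 10 / Real.log y ^ 10 := by
    refine htail.trans ?_
    rw [div_le_div_iff₀ hN0 (by positivity)]
    have h10 := FriedlanderIwaniecPrimesSquarefree.log_pow_ten_le hy1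
    have h1 : Real.log y ^ 10 ≤ (10 : ℝ) ^ 10 * (2 * N) :=
      h10.trans (mul_le_mul_of_nonneg_left hNy (by positivity))
    calc 2 * M * Real.log y ^ 10 ≤ 2 * M * ((10 : ℝ) ^ 10 * (2 * N)) :=
          mul_le_mul_of_nonneg_left h1 hM
      _ = 4 * M * 10 ^ 10 * N := by ring
  have heq : ∑ p ∈ Nat.primesLE N, w p - (Real.log (Real.log y) + (c₁ + T)) =
      (∑ p ∈ Nat.primesLE N, (fiRho p : ℝ) / p - (Real.log (Real.log y) + c₁)) -
        (T - ∑ p ∈ Nat.primesLE N, (w p - (fiRho p : ℝ) / p)) := by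
    rw [hsum]
    ring
  rw [heq]
  calc |(∑ p ∈ Nat.primesLE N, (fiRho p : ℝ) / p - (Real.log (Real.log y) + c₁)) -
        (T - ∑ p ∈ Nat.primesLE N, (w p - (fiRho p : ℝ) / p))|
      ≤ |∑ p ∈ Nat.primesLE N, (fiRho p : ℝ) / p - (Real.log (Real.log y) + c₁)| +
        |T - ∑ p ∈ Nat.primesLE N, (w p - (fiRho p : ℝ) / p)| := abs_sub _ _
    _ ≤ C₁ / Real.log y ^ 10 + 4 * M * 10 ^ 10 / Real.log y ^ 10 :=
        add_le_add hmain htail'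
    _ = (C₁ + 4 * M * 10 ^ 10) / Real.log y ^ 10 := by ring

open FriedlanderIwaniecPrimes in
/-- **(2.7) for the density (3.16), PROVED** (FI §3, after Prop. 3.5: "The asymptotic formula
(2.7) is derived from the Prime Number Theorem for the primes in residue classes modulo four"):
there are `c, K` with `|∑_{p ≤ y} g(p) − (log log y + c)| ≤ K (log y)^{-10}` for all `y ≥ 2`.
Proof: `g(p) = ρ(p)/p − χ₄(p)/p²` (`fiDensity_prime_eq_fiRho_div_sub`), so `|g(p) − ρ(p)/p| ≤ 1/p²`,
and `sum_primesLE_eq_loglog_of_abs_sub_fiRho_div_le` (the prime number theorem modulo `4` via the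
prime ideal theorem for `ℚ(i)`, plus an absolutely convergent tail).
[cite: FriedlanderIwaniecAnnals1998, §3, paragraph after Proposition 3.5, hypothesis (2.7)] -/
theorem FriedlanderIwaniec1998_hyp27_holds : FriedlanderIwaniec1998_hyp27 := by
  refine sum_primesLE_eq_loglog_of_abs_sub_fiRho_div_le (M := 1) fun p hp => ?_
  have hp0 : (0 : ℝ) < p := by exact_mod_cast hp.pos
  rw [fiDensity_prime_eq_fiRho_div_sub hp, sub_sub_cancel_left, abs_neg, abs_div,
    abs_of_pos (by positivity : (0 : ℝ) < (p : ℝ) ^ 2)]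
  exact div_le_div_of_nonneg_right (abs_chi4R_le_one p) (by positivity)

/-! ### parity.S17 from the three deep inputs -/

/-- **The sieve hypotheses for `a_n` from the two FI propositions**: Propositions 3.5 and 4.1
give `B > 0` such that `a_n = #{(a, c) : a² + c⁴ = n}` satisfies (2.1)–(2.15) (with the cubefree
(2.8)) — `fiSieveSeq_hypothesesCubefree` of `FriedlanderIwaniecPrimesCrudeBound` with its
hypothesis (2.7) now discharged by `FriedlanderIwaniec1998_hyp27_holds`.
[cite: FriedlanderIwaniecAnnals1998, §§2–4] -/
theorem fiSieveSeq_hypothesesCubefree' (h35 : FriedlanderIwaniec1998_prop35)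
    (h41 : FriedlanderIwaniec1998_prop41) :
    ∃ B : ℝ, 0 < B ∧ fiSieveSeq.FI1998SieveHypothesesCubefree FriedlanderIwaniecPrimes.fiLevel
      (fun x => Real.log x ^ B) (fun x => x ^ FriedlanderIwaniecPrimes.fiEps)
      FriedlanderIwaniecPrimes.fiP :=
  fiSieveSeq_hypothesesCubefree h35 h41 FriedlanderIwaniec1998_hyp27_holds

/-- **parity.S17 from exactly the three deep inputs of Friedlander–Iwaniec's proof**:
Proposition 2.1 in the form its proof consumes (the asymptotic sieve for primes,
`FriedlanderIwaniec1998_prop21_consumed`), Proposition 3.5 (the level of distribution of `a_n`)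
and Proposition 4.1 (the bilinear form bound, §§4–26) imply
`∑∑_{a² + b⁴ ≤ x} Λ(a² + b⁴) ∼ 4π⁻¹κ x^{3/4}` (`friedlanderIwaniecSum_isEquivalent`). Everything
else in FI §§1–4 — (4.2), (4.8), (2.1)–(2.8) including (2.7), the cubefree (2.8) and the divisor
moment (2.8′), and the deduction of (1.1) — is proved in the tree.
[cite: FriedlanderIwaniecAnnals1998, Theorem 1 via Propositions 2.1, 3.5, 4.1] -/
theorem friedlanderIwaniecSum_isEquivalent_of_deepInputs
    (h21 : FriedlanderIwaniec1998_prop21_consumed) (h35 : FriedlanderIwaniec1998_prop35)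
    (h41 : FriedlanderIwaniec1998_prop41) : friedlanderIwaniecSum_isEquivalent :=
  friedlanderIwaniecSum_isEquivalent_of_consumedInputs h21 h35 h41 FriedlanderIwaniec1998_hyp27_holds

/-- **(4.7) from the three deep inputs** (`S(x) = ∑_{p ≤ x} a_p log p ∼ (16κ/π) x^{3/4}` with the
relative error `O(log log x/log x)`, `FriedlanderIwaniec1998_primeSum_asymp`).
[cite: FriedlanderIwaniecAnnals1998, (4.7)] -/
theorem FriedlanderIwaniec1998_primeSum_asymp_of_deepInputs
    (h21 : FriedlanderIwaniec1998_prop21_consumed) (h35 : FriedlanderIwaniec1998_prop35)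
    (h41 : FriedlanderIwaniec1998_prop41) : FriedlanderIwaniec1998_primeSum_asymp :=
  FriedlanderIwaniec1998_primeSum_asymp_of_consumedInputs h21 h35 h41
    FriedlanderIwaniec1998_hyp27_holds

/-- **Infinitely many primes `a² + b⁴` from the three deep inputs** (FI Theorem 1, qualitative
clause; `setOf_prime_sq_add_pow_four_infinite_of_primeSum` of `FriedlanderIwaniecPrimesInfinitude`).
[cite: FriedlanderIwaniecAnnals1998, Theorem 1] -/
theorem setOf_prime_sq_add_pow_four_infinite_of_deepInputs
    (h21 : FriedlanderIwaniec1998_prop21_consumed) (h35 : FriedlanderIwaniec1998_prop35)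
    (h41 : FriedlanderIwaniec1998_prop41) : setOf_prime_sq_add_pow_four_infinite :=
  setOf_prime_sq_add_pow_four_infinite_of_primeSum
    (FriedlanderIwaniec1998_primeSum_asymp_of_deepInputs h21 h35 h41)

/-! ### parity.S17 from the three PRINTED named facts (the squarefree-supported route)

`FriedlanderIwaniecPrimesSquarefreeProofs` applies Proposition 2.1 AS PRINTED
(`FriedlanderIwaniec1998_prop21`) to the squarefree-supported sequence `μ²(n) a_n` and obtains
parity.S17 from `_prop21`, `_prop35`, `_prop41` and `_hyp27` (`…_of_sq_inputs`); with (2.7) now a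
theorem, three printed named facts remain. -/

/-- **(4.7) from Propositions 2.1, 3.5, 4.1 as printed** (`…_of_sq_inputs` of
`FriedlanderIwaniecPrimesSquarefreeProofs` with (2.7) discharged).
[cite: FriedlanderIwaniecAnnals1998, (4.7)] -/
theorem FriedlanderIwaniec1998_primeSum_asymp_of_printedInputs
    (h21 : FriedlanderIwaniec1998_prop21) (h35 : FriedlanderIwaniec1998_prop35)
    (h41 : FriedlanderIwaniec1998_prop41) : FriedlanderIwaniec1998_primeSum_asymp :=
  FriedlanderIwaniec1998_primeSum_asymp_of_sq_inputs h21 h35 h41 FriedlanderIwaniec1998_hyp27_holds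

/-- **parity.S17 from Propositions 2.1, 3.5, 4.1 as printed**: Friedlander–Iwaniec's Theorem 1,
`∑∑_{a² + b⁴ ≤ x} Λ(a² + b⁴) ∼ 4π⁻¹κ x^{3/4}`, follows from exactly the three deep named facts of
[FriedlanderIwaniecAnnals1998] — the asymptotic sieve for primes (Prop. 2.1), the level of
distribution (Prop. 3.5) and the bilinear form bound (Prop. 4.1, §§4–26) — everything else being
proved in the tree. [cite: FriedlanderIwaniecAnnals1998, Theorem 1 via Propositions 2.1, 3.5, 4.1] -/
theorem friedlanderIwaniecSum_isEquivalent_of_printedInputs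
    (h21 : FriedlanderIwaniec1998_prop21) (h35 : FriedlanderIwaniec1998_prop35)
    (h41 : FriedlanderIwaniec1998_prop41) : friedlanderIwaniecSum_isEquivalent :=
  friedlanderIwaniecSum_isEquivalent_of_sq_inputs h21 h35 h41 FriedlanderIwaniec1998_hyp27_holds

/-- **Infinitely many primes `a² + b⁴` from Propositions 2.1, 3.5, 4.1 as printed**
(`setOf_prime_sq_add_pow_four_infinite_of_sq_inputs` with (2.7) discharged).
[cite: FriedlanderIwaniecAnnals1998, Theorem 1] -/
theorem setOf_prime_sq_add_pow_four_infinite_of_printedInputs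
    (h21 : FriedlanderIwaniec1998_prop21) (h35 : FriedlanderIwaniec1998_prop35)
    (h41 : FriedlanderIwaniec1998_prop41) : setOf_prime_sq_add_pow_four_infinite :=
  setOf_prime_sq_add_pow_four_infinite_of_sq_inputs h21 h35 h41 FriedlanderIwaniec1998_hyp27_holds

end Literature.NumberTheory.Sieve

end
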